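import Summits.KontsevichZagierPeriods.KontsevichZagierPeriods.Theorems.TerasomaMultiplicationMultiplicationAccessibleCornerGraphRepsGen

/-!
# `MultiplicationAccessible` (stmt-KontsevichZagierPeriods-12305), line `shifted-family-prime-sieve`:
the lateral Stokes component `Vθ k` on the closed `θ_k`-band, all `p = n + 2` (`cornerThetaFactsGen`)

Coordinates `w = (θ₁, …, θ_{n+1}, y, v)`, `u = Fin.init w`, weights `Θ₀ = 1 − Σθ_i`, `Θ_{i+1} = θ_i`,
box coordinates `t_j = T u j = 1 − yΘ_j`, `Z = (∏ t_j)^(1/p)`, `y·S = 1 − ∏ t_j` (Vieta),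
`H = (Σ_{j<p} Z^j)/S`, `K = (∏ Θ_j)^(s−1)`, cyclic monomials `M_j = t_j^x ∏_m t_{j+m+1}^(x+(m+1)/p−1)`,
`P = v^(px−1)(1 − vZ)^(ps−1)H^(ps)K` and `Vθ k = P·θ_k·(Σ_j Θ_j(M_{k+1} − M_j))/y`. On the CLOSED
`θ_k`-band `Wc` (`θ_k ≥ 0`, `Σθ ≤ 1`, `yΘ₀ ≤ 1`, `yθ_k ≤ 1`, the other chart constraints strict) and
for `x ≥ 2`, `s ≥ 3` we prove the three analytic prerequisites of the rule-3 move in the direction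
`θ_k`: `Vθ k` is `ℚ`-semialgebraic on `Wc` (composition of semialgebraic operations — there all real
powers have non-negative bases and non-zero rational exponents, and `S > 0` since `y·S = 1 − ∏ t_j`
with some `Θ_j ≥ 1/p`); `Vθ k` is continuous on `Wc` (exponents `≥ 0`, `S, y ≠ 0`), hence along
the closed `θ_k`-fibres; and `Vθ k` vanishes at the four kinds of fibre ends (`θ_k = 0`;
`Σθ = 1 ⇒ Θ₀ = 0 ⇒ K = 0`; `yΘ₀ = 1 ⇒ t₀ = 0` and `yθ_k = 1 ⇒ t_{k+1} = 0`, and a vanishing box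
coordinate kills every `M_j`). Dimension-`p` version of `CornerTheta1.isSemialgebraicFunOn_c0` /
`continuousOn_c0_cons` / `c0_cons_ends`.
References: Kontsevich–Zagier 2001 §1.2 rule (3); Bochnak–Coste–Roy 1998 Prop. 2.2.6.
-/

noncomputable section

open MeasureTheory Set Real
open scoped BigOperators
open Literature.NumberTheory.Transcendental
open Literature.NumberTheory.Transcendental.KZ
open Literature.ModelTheory.ExponentialFields (IsSemialgebraic isSemialgebraic_setOf_eval_pos
  isSemialgebraic_setOf_eval_lt isSemialgebraic_setOf_eval_le)
open MvPolynomial (aeval X C)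

namespace Summit.KontsevichZagierPeriods.TerasomaMultiplication.MultiplicationAccessible

namespace CornerThetaFacts

variable {n : ℕ}

/-- The closed `θ_k`-band `Wc` is `ℚ`-semialgebraic (a finite Boolean combination of polynomial
inequalities). [folklore] -/
theorem isSemialgebraic_Wc (n : ℕ) (k : Fin (n + 1)) :
    IsSemialgebraic ℚ {w : Fin (n + 3) → ℝ | (∀ i : Fin (n + 1), i ≠ k → 0 < w (Fin.castSucc (Fin.castSucc i))) ∧ ∑ i ∈ Finset.univ.erase k, w (Fin.castSucc (Fin.castSucc i)) < 1 ∧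
      0 < w (Fin.castSucc (Fin.last (n + 1))) ∧ w (Fin.castSucc (Fin.last (n + 1))) * (1 - ∑ i ∈ Finset.univ.erase k, w (Fin.castSucc (Fin.castSucc i))) < 2 ∧
      (∀ i : Fin (n + 1), i ≠ k → w (Fin.castSucc (Fin.last (n + 1))) * w (Fin.castSucc (Fin.castSucc i)) < 1) ∧ 0 < w (Fin.last (n + 2)) ∧ w (Fin.last (n + 2)) < 1 ∧
      0 ≤ w (Fin.castSucc (Fin.castSucc k)) ∧ ∑ i : Fin (n + 1), w (Fin.castSucc (Fin.castSucc i)) ≤ 1 ∧ w (Fin.castSucc (Fin.last (n + 1))) * (1 - ∑ i : Fin (n + 1), w (Fin.castSucc (Fin.castSucc i))) ≤ 1 ∧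
      w (Fin.castSucc (Fin.last (n + 1))) * w (Fin.castSucc (Fin.castSucc k)) ≤ 1} := by
  have pos := fun p : MvPolynomial (Fin (n + 3)) ℚ => isSemialgebraic_setOf_eval_pos (k := ℚ) (R := ℝ) p
  have lt := fun p q : MvPolynomial (Fin (n + 3)) ℚ => isSemialgebraic_setOf_eval_lt (k := ℚ) (R := ℝ) p q
  have le := fun p q : MvPolynomial (Fin (n + 3)) ℚ => isSemialgebraic_setOf_eval_le (k := ℚ) (R := ℝ) p q
  have h1 := IsSemialgebraic.biInter (Finset.univ.erase k) _ fun (i : Fin (n + 1)) _ =>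
    pos (X (Fin.castSucc (Fin.castSucc i)))
  have h5 := IsSemialgebraic.biInter (Finset.univ.erase k) _ fun (i : Fin (n + 1)) _ =>
    lt (X (Fin.castSucc (Fin.last (n + 1))) * X (Fin.castSucc (Fin.castSucc i))) 1
  convert (((((((((h1.inter (lt (∑ i ∈ Finset.univ.erase k, X (Fin.castSucc (Fin.castSucc i))) 1)).inter
    (pos (X (Fin.castSucc (Fin.last (n + 1)))))).inter (lt (X (Fin.castSucc (Fin.last (n + 1))) *
    (1 - ∑ i ∈ Finset.univ.erase k, X (Fin.castSucc (Fin.castSucc i)))) 2)).inter h5).inter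
    (pos (X (Fin.last (n + 2))))).inter (lt (X (Fin.last (n + 2))) 1)).inter
    (le 0 (X (Fin.castSucc (Fin.castSucc k))))).inter
    (le (∑ i : Fin (n + 1), X (Fin.castSucc (Fin.castSucc i))) 1)).inter
    (le (X (Fin.castSucc (Fin.last (n + 1))) * (1 - ∑ i : Fin (n + 1), X (Fin.castSucc (Fin.castSucc i)))) 1)).inter
    (le (X (Fin.castSucc (Fin.last (n + 1))) * X (Fin.castSucc (Fin.castSucc k))) 1) using 1
  ext w
  simp only [map_sum, map_sub, map_mul, map_one, map_zero, map_ofNat, MvPolynomial.aeval_X,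
    mem_setOf_eq, mem_inter_iff, mem_iInter, Finset.mem_erase, Finset.mem_univ, and_true, ne_eq]
  tauto

/-- **Sign conditions on the closed `θ_k`-band**: all `Θ_j ≥ 0`, all `t_j = T u j ≥ 0`, `S > 0`
(`y·S = 1 − ∏ t_j > 0`: every `t_j ∈ [0, 1]` and `t_{j₀} < 1` for a `Θ_{j₀} > 0`, which exists as
`Σ Θ_j = 1`), `y > 0` and `v ∈ [0, 1]`. [folklore] -/
theorem band_sign {Θ T : (Fin (n + 2) → ℝ) → Fin (n + 2) → ℝ} {S : (Fin (n + 2) → ℝ) → ℝ}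
    (hΘ0 : ∀ u, Θ u 0 = 1 - ∑ i : Fin (n + 1), u (Fin.castSucc i))
    (hΘs : ∀ u (i : Fin (n + 1)), Θ u i.succ = u (Fin.castSucc i))
    (hT : ∀ u k, T u k = 1 - u (Fin.last (n + 1)) * Θ u k)
    (hS : ∀ u, S u = ∑ j ∈ Finset.range (n + 2), (-1:ℝ) ^ j * u (Fin.last (n + 1)) ^ j *
      ∑ A ∈ Finset.powersetCard (j + 1) (Finset.univ : Finset (Fin (n + 2))), ∏ k ∈ A, Θ u k)
    {k : Fin (n + 1)} {w : Fin (n + 3) → ℝ}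
    (hw : (∀ i : Fin (n + 1), i ≠ k → 0 < w (Fin.castSucc (Fin.castSucc i))) ∧ ∑ i ∈ Finset.univ.erase k, w (Fin.castSucc (Fin.castSucc i)) < 1 ∧
      0 < w (Fin.castSucc (Fin.last (n + 1))) ∧ w (Fin.castSucc (Fin.last (n + 1))) * (1 - ∑ i ∈ Finset.univ.erase k, w (Fin.castSucc (Fin.castSucc i))) < 2 ∧
      (∀ i : Fin (n + 1), i ≠ k → w (Fin.castSucc (Fin.last (n + 1))) * w (Fin.castSucc (Fin.castSucc i)) < 1) ∧ 0 < w (Fin.last (n + 2)) ∧ w (Fin.last (n + 2)) < 1 ∧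
      0 ≤ w (Fin.castSucc (Fin.castSucc k)) ∧ ∑ i : Fin (n + 1), w (Fin.castSucc (Fin.castSucc i)) ≤ 1 ∧ w (Fin.castSucc (Fin.last (n + 1))) * (1 - ∑ i : Fin (n + 1), w (Fin.castSucc (Fin.castSucc i))) ≤ 1 ∧
      w (Fin.castSucc (Fin.last (n + 1))) * w (Fin.castSucc (Fin.castSucc k)) ≤ 1) :
    (∀ j, 0 ≤ Θ (Fin.init w) j) ∧ (∀ j, 0 ≤ T (Fin.init w) j) ∧ 0 < S (Fin.init w) ∧
      0 < w (Fin.castSucc (Fin.last (n + 1))) ∧ 0 ≤ w (Fin.last (n + 2)) ∧ w (Fin.last (n + 2)) ≤ 1 := by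
  obtain ⟨hpos, -, hy, -, hlt, hv0, hv1, hk0, hsum, h0, hk1⟩ := hw
  have iy : Fin.init w (Fin.last (n + 1)) = w (Fin.castSucc (Fin.last (n + 1))) := rfl
  have iθ : ∀ i : Fin (n + 1), Fin.init w (Fin.castSucc i) = w (Fin.castSucc (Fin.castSucc i)) :=
    fun _ => rfl
  have hΘT : ∀ j, 0 ≤ Θ (Fin.init w) j ∧ 0 ≤ T (Fin.init w) j := by
    refine Fin.cases ?_ (fun i => ?_)
    · rw [hT, hΘ0, iy]; simp only [iθ]; exact ⟨by linarith, by linarith⟩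
    · rw [hT, hΘs, iy, iθ]
      by_cases hik : i = k
      · subst hik; exact ⟨hk0, by linarith⟩
      · exact ⟨(hpos i hik).le, by linarith [hlt i hik]⟩
  have hT1 : ∀ j, T (Fin.init w) j ≤ 1 := fun j => by rw [hT, iy]; linarith [mul_nonneg hy.le (hΘT j).1]
  have hS0 : 0 < S (Fin.init w) := by
    obtain ⟨j₀, -, hj₀⟩ := Finset.exists_lt_of_sum_lt (s := Finset.univ) (f := fun _ => (0:ℝ))
      (g := Θ (Fin.init w)) (by rw [Finset.sum_const_zero, CornerGraphGen.sum_theta hΘ0 hΘs]; exact one_pos)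
    have hlt1 : ∏ j, T (Fin.init w) j < 1 := by
      rw [← Finset.mul_prod_erase Finset.univ _ (Finset.mem_univ j₀)]
      refine (mul_le_of_le_one_right (hΘT j₀).2
        (Finset.prod_le_one (fun j _ => (hΘT j).2) fun j _ => hT1 j)).trans_lt ?_
      rw [hT, iy]
      linarith [mul_pos hy hj₀]
    have hyS : w (Fin.castSucc (Fin.last (n + 1))) * S (Fin.init w) = 1 - ∏ j, T (Fin.init w) j := by
      rw [CornerGraphGen.prod_T_eq hT hS (Fin.init w), iy]; ring
    exact pos_of_mul_pos_right (by rw [hyS]; linarith) hy.le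
  exact ⟨fun j => (hΘT j).1, fun j => (hΘT j).2, hS0, hy, hv0.le, hv1.le⟩

/-- **`Vθ k` is `ℚ`-semialgebraic** on every `ℚ`-semialgebraic set carrying the sign conditions of
the closed band (explicit composition of semialgebraic operations; rational powers of non-negative
bases with non-zero exponents by `IsSemialgebraicFunOn.rpow_ratCast_of_nonneg`, `S` through Vieta
`S = (1 − ∏ t_j)/y`). [cite: BochnakCosteRoy1998, Prop. 2.2.6] -/
theorem isSemialgebraicFunOn_V {x s : ℚ} (hx : 2 ≤ x) (hs : 3 ≤ s)
    {Θ T : (Fin (n + 2) → ℝ) → Fin (n + 2) → ℝ} {Z S H K : (Fin (n + 2) → ℝ) → ℝ}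
    {M : (Fin (n + 2) → ℝ) → Fin (n + 2) → ℝ} {P : (Fin (n + 3) → ℝ) → ℝ}
    (hΘ0 : ∀ u, Θ u 0 = 1 - ∑ i : Fin (n + 1), u (Fin.castSucc i))
    (hΘs : ∀ u (i : Fin (n + 1)), Θ u i.succ = u (Fin.castSucc i))
    (hT : ∀ u k, T u k = 1 - u (Fin.last (n + 1)) * Θ u k)
    (hZ : ∀ u, Z u = (∏ k, T u k) ^ (1 / ((n:ℝ) + 2)))
    (hS : ∀ u, S u = ∑ j ∈ Finset.range (n + 2), (-1:ℝ) ^ j * u (Fin.last (n + 1)) ^ j *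
      ∑ A ∈ Finset.powersetCard (j + 1) (Finset.univ : Finset (Fin (n + 2))), ∏ k ∈ A, Θ u k)
    (hH : ∀ u, H u = (∑ j ∈ Finset.range (n + 2), Z u ^ j) / S u)
    (hK : ∀ u, K u = (∏ k, Θ u k) ^ ((s:ℝ) - 1))
    (hM : ∀ u k, M u k = (T u k) ^ (x:ℝ) * ∏ j : Fin (n + 1), (T u (k + j.succ)) ^ ((x:ℝ) + (((j:ℕ):ℝ) + 1) / ((n:ℝ) + 2) - 1))
    (hP : ∀ w, P w = (w (Fin.last (n + 2))) ^ (((n:ℝ) + 2) * (x:ℝ) - 1) *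
      (1 - w (Fin.last (n + 2)) * Z (Fin.init w)) ^ (((n:ℝ) + 2) * (s:ℝ) - 1) * H (Fin.init w) ^ (((n:ℝ) + 2) * (s:ℝ)) * K (Fin.init w))
    {V : (Fin (n + 3) → ℝ) → ℝ} {k : Fin (n + 1)}
    (hV : ∀ w, V w = P w * (Fin.init w : Fin (n + 2) → ℝ) (Fin.castSucc k) *
      (∑ j, Θ (Fin.init w) j * (M (Fin.init w) k.succ - M (Fin.init w) j)) / (Fin.init w : Fin (n + 2) → ℝ) (Fin.last (n + 1)))
    {σ : Set (Fin (n + 3) → ℝ)} (hσ : IsSemialgebraic ℚ σ)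
    (hsg : ∀ w ∈ σ, (∀ j, 0 ≤ Θ (Fin.init w) j) ∧ (∀ j, 0 ≤ T (Fin.init w) j) ∧ 0 < S (Fin.init w) ∧
      0 < w (Fin.castSucc (Fin.last (n + 1))) ∧ 0 ≤ w (Fin.last (n + 2)) ∧ w (Fin.last (n + 2)) ≤ 1) :
    IsSemialgebraicFunOn ℚ σ V := by
  have iy : ∀ w : Fin (n + 3) → ℝ, Fin.init w (Fin.last (n + 1)) = w (Fin.castSucc (Fin.last (n + 1))) :=
    fun _ => rfl
  -- derived signs: `∏ t_j ∈ [0, 1]`, `Z ∈ [0, 1]`, `1 − vZ ≥ 0`, `H ≥ 0`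
  have sg : ∀ w ∈ σ, 0 ≤ ∏ j, T (Fin.init w) j ∧ 0 ≤ Z (Fin.init w) ∧
      0 ≤ 1 - w (Fin.last (n + 2)) * Z (Fin.init w) ∧ 0 ≤ H (Fin.init w) := by
    intro w hw
    obtain ⟨hΘ, hT0, hS0, hy, -, hv1⟩ := hsg w hw
    have hP0 : 0 ≤ ∏ j, T (Fin.init w) j := Finset.prod_nonneg fun j _ => hT0 j
    have hP1 : ∏ j, T (Fin.init w) j ≤ 1 := Finset.prod_le_one (fun j _ => hT0 j) fun j _ => by
      rw [hT, iy]; linarith [mul_nonneg hy.le (hΘ j)]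
    have hZ0 : 0 ≤ Z (Fin.init w) := by rw [hZ]; exact rpow_nonneg hP0 _
    have hZ1 : Z (Fin.init w) ≤ 1 := by rw [hZ]; exact rpow_le_one hP0 hP1 (by positivity)
    refine ⟨hP0, hZ0, by nlinarith [mul_le_one₀ hv1 hZ0 hZ1], ?_⟩
    rw [hH]
    exact div_nonneg (Finset.sum_nonneg fun j _ => pow_nonneg hZ0 _) hS0.le
  have hc : ∀ i, IsSemialgebraicFunOn ℚ σ (fun w : Fin (n + 3) → ℝ => w i) :=
    isSemialgebraicFunOn_apply hσ
  have h1 : IsSemialgebraicFunOn ℚ σ (fun _ : Fin (n + 3) → ℝ => (1:ℝ)) :=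
    isSemialgebraicFunOn_const_of_isAlgebraic hσ isAlgebraic_one
  have rp : ∀ {f : (Fin (n + 3) → ℝ) → ℝ} (_ : IsSemialgebraicFunOn ℚ σ f) (_ : ∀ w ∈ σ, 0 ≤ f w)
      (e : ℚ) (_ : e ≠ 0), IsSemialgebraicFunOn ℚ σ (fun w => f w ^ (e : ℝ)) :=
    fun hf hnn e he => hf.rpow_ratCast_of_nonneg hnn he
  -- the polynomial atoms `Θ_j`, `t_j`, `∏ t_j`
  have hΘ' : ∀ j, IsSemialgebraicFunOn ℚ σ (fun w => Θ (Fin.init w) j) := by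
    refine Fin.cases ?_ (fun i => ?_)
    · exact (h1.fun_sub (IsSemialgebraicFunOn.fun_finsetSum Finset.univ hσ
        fun i _ => hc (Fin.castSucc (Fin.castSucc i)))).congr fun w _ => by rw [hΘ0]; rfl
    · exact (hc (Fin.castSucc (Fin.castSucc i))).congr fun w _ => by rw [hΘs]; rfl
  have hT' : ∀ j, IsSemialgebraicFunOn ℚ σ (fun w => T (Fin.init w) j) := fun j =>
    (h1.fun_sub ((hc (Fin.castSucc (Fin.last (n + 1)))).fun_mul (hΘ' j))).congr fun w _ => by
      rw [hT]; rfl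
  have hPT : IsSemialgebraicFunOn ℚ σ (fun w => ∏ j, T (Fin.init w) j) :=
    IsSemialgebraicFunOn.fun_finsetProd Finset.univ hσ fun j _ => hT' j
  -- `Z`, `S`, `H`, `K`
  have hZ' : IsSemialgebraicFunOn ℚ σ (fun w => Z (Fin.init w)) := by
    refine (rp hPT (fun w hw => (sg w hw).1) (1 / ((n:ℚ) + 2)) (by positivity)).congr fun w _ => ?_
    rw [hZ]; push_cast; ring_nf
  have hS' : IsSemialgebraicFunOn ℚ σ (fun w => S (Fin.init w)) := by
    refine ((h1.fun_sub hPT).div (hc (Fin.castSucc (Fin.last (n + 1))))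
      fun w hw => (hsg w hw).2.2.2.1.ne').congr fun w hw => ?_
    rw [div_eq_iff (hsg w hw).2.2.2.1.ne', CornerGraphGen.prod_T_eq hT hS (Fin.init w), iy]
    ring
  have hH' : IsSemialgebraicFunOn ℚ σ (fun w => H (Fin.init w)) :=
    ((IsSemialgebraicFunOn.fun_finsetSum (Finset.range (n + 2)) hσ fun j _ => hZ'.fun_pow j).div hS'
      fun w hw => (hsg w hw).2.2.1.ne').congr fun w _ => by rw [hH]
  have hK' : IsSemialgebraicFunOn ℚ σ (fun w => K (Fin.init w)) := by
    have hs1 : (s - 1 : ℚ) ≠ 0 := by intro h; linarith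
    refine (rp (IsSemialgebraicFunOn.fun_finsetProd Finset.univ hσ fun j _ => hΘ' j)
      (fun w hw => Finset.prod_nonneg fun j _ => (hsg w hw).1 j) _ hs1).congr fun w _ => ?_
    rw [hK]; push_cast; rfl
  -- the cyclic monomials
  have hx0 : (x : ℚ) ≠ 0 := by intro h; rw [h] at hx; norm_num at hx
  have he : ∀ m : Fin (n + 1), (x + (((m:ℕ):ℚ) + 1) / ((n:ℚ) + 2) - 1 : ℚ) ≠ 0 := fun m =>
    ne_of_gt (by have : (0:ℚ) < (((m:ℕ):ℚ) + 1) / ((n:ℚ) + 2) := (by positivity); linarith)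
  have hM' : ∀ j, IsSemialgebraicFunOn ℚ σ (fun w => M (Fin.init w) j) := fun j => by
    refine ((rp (hT' j) (fun w hw => (hsg w hw).2.1 j) x hx0).fun_mul
      (IsSemialgebraicFunOn.fun_finsetProd Finset.univ hσ fun m _ =>
        rp (hT' (j + Fin.succ m)) (fun w hw => (hsg w hw).2.1 _) _ (he m))).congr fun w _ => ?_
    rw [hM]; push_cast; rfl
  -- the prefactor `P`
  have hP' : IsSemialgebraicFunOn ℚ σ P := by
    have hn : (0:ℚ) ≤ n := n.cast_nonneg
    have e1 : (((n:ℚ) + 2) * x - 1 : ℚ) ≠ 0 := by nlinarith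
    have e2 : (((n:ℚ) + 2) * s - 1 : ℚ) ≠ 0 := by nlinarith
    have e3 : (((n:ℚ) + 2) * s : ℚ) ≠ 0 := by positivity
    have hv := rp (hc (Fin.last (n + 2))) (fun w hw => (hsg w hw).2.2.2.2.1) _ e1
    have hq := rp (h1.fun_sub ((hc (Fin.last (n + 2))).fun_mul hZ')) (fun w hw => (sg w hw).2.2.1) _ e2
    have hr := rp hH' (fun w hw => (sg w hw).2.2.2) _ e3
    refine (((hv.fun_mul hq).fun_mul hr).fun_mul hK').congr fun w _ => ?_
    rw [hP]; push_cast; rfl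
  refine (((hP'.fun_mul (hc (Fin.castSucc (Fin.castSucc k)))).fun_mul
    (IsSemialgebraicFunOn.fun_finsetSum Finset.univ hσ fun j _ =>
      (hΘ' j).fun_mul ((hM' k.succ).fun_sub (hM' j)))).div (hc (Fin.castSucc (Fin.last (n + 1))))
    fun w hw => (hsg w hw).2.2.2.1.ne').congr fun w _ => ?_
  rw [hV]; rfl

/-- **`Vθ k` is continuous** on every set on which `S ≠ 0` and `y ≠ 0` (all real powers have
exponents `≥ 0`, `ContinuousOn.rpow_const`). [folklore] -/
theorem continuousOn_V {x s : ℚ} (hx : 2 ≤ x) (hs : 3 ≤ s)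
    {Θ T : (Fin (n + 2) → ℝ) → Fin (n + 2) → ℝ} {Z S H K : (Fin (n + 2) → ℝ) → ℝ}
    {M : (Fin (n + 2) → ℝ) → Fin (n + 2) → ℝ} {P : (Fin (n + 3) → ℝ) → ℝ}
    (hΘ0 : ∀ u, Θ u 0 = 1 - ∑ i : Fin (n + 1), u (Fin.castSucc i))
    (hΘs : ∀ u (i : Fin (n + 1)), Θ u i.succ = u (Fin.castSucc i))
    (hT : ∀ u k, T u k = 1 - u (Fin.last (n + 1)) * Θ u k)
    (hZ : ∀ u, Z u = (∏ k, T u k) ^ (1 / ((n:ℝ) + 2)))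
    (hS : ∀ u, S u = ∑ j ∈ Finset.range (n + 2), (-1:ℝ) ^ j * u (Fin.last (n + 1)) ^ j *
      ∑ A ∈ Finset.powersetCard (j + 1) (Finset.univ : Finset (Fin (n + 2))), ∏ k ∈ A, Θ u k)
    (hH : ∀ u, H u = (∑ j ∈ Finset.range (n + 2), Z u ^ j) / S u)
    (hK : ∀ u, K u = (∏ k, Θ u k) ^ ((s:ℝ) - 1))
    (hM : ∀ u k, M u k = (T u k) ^ (x:ℝ) * ∏ j : Fin (n + 1), (T u (k + j.succ)) ^ ((x:ℝ) + (((j:ℕ):ℝ) + 1) / ((n:ℝ) + 2) - 1))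
    (hP : ∀ w, P w = (w (Fin.last (n + 2))) ^ (((n:ℝ) + 2) * (x:ℝ) - 1) *
      (1 - w (Fin.last (n + 2)) * Z (Fin.init w)) ^ (((n:ℝ) + 2) * (s:ℝ) - 1) * H (Fin.init w) ^ (((n:ℝ) + 2) * (s:ℝ)) * K (Fin.init w))
    {V : (Fin (n + 3) → ℝ) → ℝ} {k : Fin (n + 1)}
    (hV : ∀ w, V w = P w * (Fin.init w : Fin (n + 2) → ℝ) (Fin.castSucc k) *
      (∑ j, Θ (Fin.init w) j * (M (Fin.init w) k.succ - M (Fin.init w) j)) / (Fin.init w : Fin (n + 2) → ℝ) (Fin.last (n + 1)))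
    {σ : Set (Fin (n + 3) → ℝ)}
    (hsg : ∀ w ∈ σ, S (Fin.init w) ≠ 0 ∧ w (Fin.castSucc (Fin.last (n + 1))) ≠ 0) :
    ContinuousOn V σ := by
  have iy : ∀ w : Fin (n + 3) → ℝ, Fin.init w (Fin.last (n + 1)) = w (Fin.castSucc (Fin.last (n + 1))) :=
    fun _ => rfl
  have hx' : (2:ℝ) ≤ x := by exact_mod_cast hx
  have hs' : (3:ℝ) ≤ s := by exact_mod_cast hs
  have hn : (0:ℝ) ≤ n := n.cast_nonneg
  have hc : ∀ i, ContinuousOn (fun w : Fin (n + 3) → ℝ => w i) σ := fun i =>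
    (continuous_apply i).continuousOn
  have h1 : ContinuousOn (fun _ : Fin (n + 3) → ℝ => (1:ℝ)) σ := continuousOn_const
  -- the polynomial atoms
  have hΘ' : ∀ j, ContinuousOn (fun w => Θ (Fin.init w) j) σ := by
    refine Fin.cases ?_ (fun i => ?_)
    · exact (h1.fun_sub (continuousOn_finsetSum Finset.univ
        fun i _ => hc (Fin.castSucc (Fin.castSucc i)))).congr fun w _ => by rw [hΘ0]; rfl
    · exact (hc (Fin.castSucc (Fin.castSucc i))).congr fun w _ => by rw [hΘs]; rfl
  have hT' : ∀ j, ContinuousOn (fun w => T (Fin.init w) j) σ := fun j =>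
    (h1.fun_sub ((hc (Fin.castSucc (Fin.last (n + 1)))).fun_mul (hΘ' j))).congr fun w _ => by rw [hT]; rfl
  have hPT : ContinuousOn (fun w => ∏ j, T (Fin.init w) j) σ :=
    continuousOn_finsetProd Finset.univ fun j _ => hT' j
  -- `Z`, `S`, `H`, `K`
  have hZ' : ContinuousOn (fun w => Z (Fin.init w)) σ :=
    (hPT.rpow_const (p := 1 / ((n:ℝ) + 2)) fun w _ => Or.inr (by positivity)).congr fun w _ => by
      rw [hZ]
  have hS' : ContinuousOn (fun w => S (Fin.init w)) σ := by
    refine ((h1.fun_sub hPT).div₀ (hc (Fin.castSucc (Fin.last (n + 1)))) fun w hw => (hsg w hw).2).congr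
      fun w hw => ?_
    rw [eq_div_iff (hsg w hw).2, CornerGraphGen.prod_T_eq hT hS (Fin.init w), iy]
    ring
  have hH' : ContinuousOn (fun w => H (Fin.init w)) σ :=
    ((continuousOn_finsetSum (Finset.range (n + 2)) fun j _ => hZ'.fun_pow j).div₀ hS'
      fun w hw => (hsg w hw).1).congr fun w _ => by rw [hH]
  have hK' : ContinuousOn (fun w => K (Fin.init w)) σ :=
    ((continuousOn_finsetProd Finset.univ fun j _ => hΘ' j).rpow_const (p := (s:ℝ) - 1) fun w _ =>
      Or.inr (by linarith)).congr fun w _ => by rw [hK]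
  -- the cyclic monomials
  have he : ∀ m : Fin (n + 1), (0:ℝ) ≤ (x:ℝ) + (((m:ℕ):ℝ) + 1) / ((n:ℝ) + 2) - 1 := fun m => by
    have : (0:ℝ) ≤ (((m:ℕ):ℝ) + 1) / ((n:ℝ) + 2) := by positivity
    linarith
  have hM' : ∀ j, ContinuousOn (fun w => M (Fin.init w) j) σ := fun j =>
    (((hT' j).rpow_const (p := (x:ℝ)) fun w _ => Or.inr (by linarith)).fun_mul
      (continuousOn_finsetProd Finset.univ fun m _ =>
        (hT' (j + Fin.succ m)).rpow_const fun w _ => Or.inr (he m))).congr fun w _ => by rw [hM]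
  -- the prefactor `P`
  have hP' : ContinuousOn P σ := by
    have hv := (hc (Fin.last (n + 2))).rpow_const (p := ((n:ℝ) + 2) * (x:ℝ) - 1)
      fun w _ => Or.inr (by nlinarith)
    have hq := (h1.fun_sub ((hc (Fin.last (n + 2))).fun_mul hZ')).rpow_const (p := ((n:ℝ) + 2) * (s:ℝ) - 1)
      fun w _ => Or.inr (by nlinarith)
    have hr := hH'.rpow_const (p := ((n:ℝ) + 2) * (s:ℝ)) fun w _ => Or.inr (by nlinarith)
    exact (((hv.fun_mul hq).fun_mul hr).fun_mul hK').congr fun w _ => by rw [hP]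
  exact (((hP'.fun_mul (hc (Fin.castSucc (Fin.castSucc k)))).fun_mul
    (continuousOn_finsetSum Finset.univ fun j _ =>
      (hΘ' j).fun_mul ((hM' k.succ).fun_sub (hM' j)))).div₀ (hc (Fin.castSucc (Fin.last (n + 1))))
    fun w hw => (hsg w hw).2).congr fun w _ => by rw [hV]; rfl

/-- **A vanishing box coordinate kills every cyclic monomial**: if `t_l = 0` then `M_j = 0` for all
`j` (`M_j = t_j^x ∏_m t_{j+m+1}^(x+(m+1)/p−1)` contains `t_l` with a non-zero exponent: either
`l = j`, or `l = j + m.succ` for `m.succ = l − j`). [folklore] -/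
theorem M_eq_zero {x : ℚ} (hx : 2 ≤ x) {T M : (Fin (n + 2) → ℝ) → Fin (n + 2) → ℝ}
    (hM : ∀ u k, M u k = (T u k) ^ (x:ℝ) * ∏ j : Fin (n + 1), (T u (k + j.succ)) ^ ((x:ℝ) + (((j:ℕ):ℝ) + 1) / ((n:ℝ) + 2) - 1))
    {u : Fin (n + 2) → ℝ} {l : Fin (n + 2)} (hl : T u l = 0) (j : Fin (n + 2)) : M u j = 0 := by
  have hx' : (2:ℝ) ≤ x := by exact_mod_cast hx
  rw [hM]
  by_cases hjl : j = l
  · rw [hjl, hl, Real.zero_rpow (by linarith), zero_mul]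
  · obtain ⟨m, hm⟩ := Fin.exists_succ_eq.mpr (sub_ne_zero.mpr (Ne.symm hjl))
    refine mul_eq_zero_of_right _ (Finset.prod_eq_zero (Finset.mem_univ m) ?_)
    have he : (x:ℝ) + (((m:ℕ):ℝ) + 1) / ((n:ℝ) + 2) - 1 ≠ 0 := by
      have : (0:ℝ) < (((m:ℕ):ℝ) + 1) / ((n:ℝ) + 2) := by positivity
      exact ne_of_gt (by linarith)
    rw [hm, add_sub_cancel, hl, Real.zero_rpow he]

/-- **`Vθ k` vanishes at the four kinds of ends of the closed `θ_k`-fibres**: `θ_k = 0` (the factor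
`θ_k`), `Σθ = 1` (`Θ₀ = 0`, so `K = 0^(s−1)·… = 0`), `yΘ₀ = 1` (`t₀ = 0`) and `yθ_k = 1`
(`t_{k+1} = 0`), the last two by `M_eq_zero`. [folklore] -/
theorem V_ends {x s : ℚ} (hx : 2 ≤ x) (hs : 3 ≤ s)
    {Θ T : (Fin (n + 2) → ℝ) → Fin (n + 2) → ℝ} {Z H K : (Fin (n + 2) → ℝ) → ℝ}
    {M : (Fin (n + 2) → ℝ) → Fin (n + 2) → ℝ} {P : (Fin (n + 3) → ℝ) → ℝ}
    (hΘ0 : ∀ u, Θ u 0 = 1 - ∑ i : Fin (n + 1), u (Fin.castSucc i))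
    (hΘs : ∀ u (i : Fin (n + 1)), Θ u i.succ = u (Fin.castSucc i))
    (hT : ∀ u k, T u k = 1 - u (Fin.last (n + 1)) * Θ u k)
    (hK : ∀ u, K u = (∏ k, Θ u k) ^ ((s:ℝ) - 1))
    (hM : ∀ u k, M u k = (T u k) ^ (x:ℝ) * ∏ j : Fin (n + 1), (T u (k + j.succ)) ^ ((x:ℝ) + (((j:ℕ):ℝ) + 1) / ((n:ℝ) + 2) - 1))
    (hP : ∀ w, P w = (w (Fin.last (n + 2))) ^ (((n:ℝ) + 2) * (x:ℝ) - 1) *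
      (1 - w (Fin.last (n + 2)) * Z (Fin.init w)) ^ (((n:ℝ) + 2) * (s:ℝ) - 1) * H (Fin.init w) ^ (((n:ℝ) + 2) * (s:ℝ)) * K (Fin.init w))
    {V : (Fin (n + 3) → ℝ) → ℝ} {k : Fin (n + 1)}
    (hV : ∀ w, V w = P w * (Fin.init w : Fin (n + 2) → ℝ) (Fin.castSucc k) *
      (∑ j, Θ (Fin.init w) j * (M (Fin.init w) k.succ - M (Fin.init w) j)) / (Fin.init w : Fin (n + 2) → ℝ) (Fin.last (n + 1)))
    {w : Fin (n + 3) → ℝ}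
    (h : w (Fin.castSucc (Fin.castSucc k)) = 0 ∨ ∑ i : Fin (n + 1), w (Fin.castSucc (Fin.castSucc i)) = 1 ∨
      w (Fin.castSucc (Fin.last (n + 1))) * (1 - ∑ i : Fin (n + 1), w (Fin.castSucc (Fin.castSucc i))) = 1 ∨
      w (Fin.castSucc (Fin.last (n + 1))) * w (Fin.castSucc (Fin.castSucc k)) = 1) :
    V w = 0 := by
  have iy : Fin.init w (Fin.last (n + 1)) = w (Fin.castSucc (Fin.last (n + 1))) := rfl
  have iθ : ∀ i : Fin (n + 1), Fin.init w (Fin.castSucc i) = w (Fin.castSucc (Fin.castSucc i)) :=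
    fun _ => rfl
  have hs' : (3:ℝ) ≤ s := by exact_mod_cast hs
  have hMz : ∀ l, T (Fin.init w) l = 0 → V w = 0 := fun l hl => by
    rw [hV]
    simp only [M_eq_zero hx hM hl, sub_self, mul_zero, Finset.sum_const_zero, zero_div]
  rcases h with h | h | h | h
  · rw [hV, iθ, h, mul_zero, zero_mul, zero_div]
  · have hΘz : Θ (Fin.init w) 0 = 0 := by
      rw [hΘ0]
      simp only [iθ]
      linarith
    have hKz : K (Fin.init w) = 0 := by
      rw [hK, Finset.prod_eq_zero (Finset.mem_univ 0) hΘz, Real.zero_rpow (by linarith)]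
    rw [hV, hP, hKz, mul_zero, zero_mul, zero_mul, zero_div]
  · refine hMz 0 ?_
    rw [hT, hΘ0, iy]
    simp only [iθ]
    linarith
  · refine hMz k.succ ?_
    rw [hT, hΘs, iy, iθ]
    linarith

end CornerThetaFacts

/-- **Analysis of the lateral component `Vθ k` on the closed `θ_k`-band, all `p = n + 2`**
(registered stub `cornerThetaFactsGen` of the general-`p` corner Stokes): for `x ≥ 2`, `s ≥ 3`,
`Vθ k = P·θ_k·(Σ_j Θ_j(M_{k+1} − M_j))/y` is `ℚ`-semialgebraic on the closed band `Wc`, continuous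
along its closed `θ_k`-fibres, and zero at the four kinds of fibre ends (`θ_k = 0`; `Σθ = 1 ⇒ K = 0`;
`yΘ₀ = 1 ⇒ t₀ = 0` and `yθ_k = 1 ⇒ t_{k+1} = 0`, either of which kills every `M_j`). On `Wc` all
`Θ_j, t_j ≥ 0`, `y > 0` and `S > 0` (`y·S = 1 − ∏ t_j`, some `Θ_j ≥ 1/p`), so all real powers have
non-negative bases and positive exponents. [cite: KontsevichZagier2001, §1.2 rule (3)] -/
theorem cornerThetaFactsGen : ∀ (n : ℕ) (x s : ℚ), 2 ≤ x → 3 ≤ s → ∀ (Θ T : (Fin (n + 2) → ℝ) → Fin (n + 2) → ℝ) (Z S H K : (Fin (n + 2) → ℝ) → ℝ)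
      (M : (Fin (n + 2) → ℝ) → Fin (n + 2) → ℝ) (P : (Fin (n + 3) → ℝ) → ℝ),
    (∀ u, Θ u 0 = 1 - ∑ i : Fin (n + 1), u (Fin.castSucc i)) → (∀ u (i : Fin (n + 1)), Θ u i.succ = u (Fin.castSucc i)) →
    (∀ u k, T u k = 1 - u (Fin.last (n + 1)) * Θ u k) →
    (∀ u, Z u = (∏ k, T u k) ^ (1 / ((n:ℝ) + 2))) →
    (∀ u, S u = ∑ j ∈ Finset.range (n + 2), (-1:ℝ) ^ j * u (Fin.last (n + 1)) ^ j *
      ∑ A ∈ Finset.powersetCard (j + 1) (Finset.univ : Finset (Fin (n + 2))), ∏ k ∈ A, Θ u k) →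
    (∀ u, H u = (∑ j ∈ Finset.range (n + 2), Z u ^ j) / S u) →
    (∀ u, K u = (∏ k, Θ u k) ^ ((s:ℝ) - 1)) →
    (∀ u k, M u k = (T u k) ^ (x:ℝ) * ∏ j : Fin (n + 1), (T u (k + j.succ)) ^ ((x:ℝ) + (((j:ℕ):ℝ) + 1) / ((n:ℝ) + 2) - 1)) →
    (∀ w, P w = (w (Fin.last (n + 2))) ^ (((n:ℝ) + 2) * (x:ℝ) - 1) *
      (1 - w (Fin.last (n + 2)) * Z (Fin.init w)) ^ (((n:ℝ) + 2) * (s:ℝ) - 1) * H (Fin.init w) ^ (((n:ℝ) + 2) * (s:ℝ)) * K (Fin.init w)) →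
    ∀ (Vθ : Fin (n + 1) → (Fin (n + 3) → ℝ) → ℝ), (∀ (i : Fin (n + 1)) w, Vθ i w = P w * (Fin.init w : Fin (n + 2) → ℝ) (Fin.castSucc i) *
      (∑ j, Θ (Fin.init w) j * (M (Fin.init w) i.succ - M (Fin.init w) j)) / (Fin.init w : Fin (n + 2) → ℝ) (Fin.last (n + 1))) →
    ∀ (k : Fin (n + 1)) (Wc : Set (Fin (n + 3) → ℝ)),
    Wc = {w : Fin (n + 3) → ℝ | (∀ i : Fin (n + 1), i ≠ k → 0 < w (Fin.castSucc (Fin.castSucc i))) ∧ ∑ i ∈ Finset.univ.erase k, w (Fin.castSucc (Fin.castSucc i)) < 1 ∧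
      0 < w (Fin.castSucc (Fin.last (n + 1))) ∧ w (Fin.castSucc (Fin.last (n + 1))) * (1 - ∑ i ∈ Finset.univ.erase k, w (Fin.castSucc (Fin.castSucc i))) < 2 ∧
      (∀ i : Fin (n + 1), i ≠ k → w (Fin.castSucc (Fin.last (n + 1))) * w (Fin.castSucc (Fin.castSucc i)) < 1) ∧ 0 < w (Fin.last (n + 2)) ∧ w (Fin.last (n + 2)) < 1 ∧
      0 ≤ w (Fin.castSucc (Fin.castSucc k)) ∧ ∑ i : Fin (n + 1), w (Fin.castSucc (Fin.castSucc i)) ≤ 1 ∧ w (Fin.castSucc (Fin.last (n + 1))) * (1 - ∑ i : Fin (n + 1), w (Fin.castSucc (Fin.castSucc i))) ≤ 1 ∧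
      w (Fin.castSucc (Fin.last (n + 1))) * w (Fin.castSucc (Fin.castSucc k)) ≤ 1} →
    IsSemialgebraicFunOn ℚ Wc (Vθ k) ∧
    (∀ w ∈ Wc, ContinuousOn (fun a => Vθ k (Function.update w (Fin.castSucc (Fin.castSucc k) : Fin (n + 3)) a)) {a | Function.update w (Fin.castSucc (Fin.castSucc k) : Fin (n + 3)) a ∈ Wc}) ∧
    (∀ w ∈ Wc, (w (Fin.castSucc (Fin.castSucc k)) = 0 ∨ ∑ i : Fin (n + 1), w (Fin.castSucc (Fin.castSucc i)) = 1 ∨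
      w (Fin.castSucc (Fin.last (n + 1))) * (1 - ∑ i : Fin (n + 1), w (Fin.castSucc (Fin.castSucc i))) = 1 ∨ w (Fin.castSucc (Fin.last (n + 1))) * w (Fin.castSucc (Fin.castSucc k)) = 1) → Vθ k w = 0) := by
  intro n x s hx hs Θ T Z S H K M P hΘ0 hΘs hT hZ hS hH hK hM hP Vθ hVθ k Wc hWc
  have hsg := fun w (hw : w ∈ Wc) =>
    CornerThetaFacts.band_sign hΘ0 hΘs hT hS (k := k) (w := w) (by rw [hWc] at hw; exact hw)
  have hWsa : IsSemialgebraic ℚ Wc := by rw [hWc]; exact CornerThetaFacts.isSemialgebraic_Wc n k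
  refine ⟨CornerThetaFacts.isSemialgebraicFunOn_V hx hs hΘ0 hΘs hT hZ hS hH hK hM hP (hVθ k) hWsa hsg,
    fun w _ => ?_, fun w _ h => CornerThetaFacts.V_ends hx hs hΘ0 hΘs hT hK hM hP (hVθ k) h⟩
  have hcont : ContinuousOn (Vθ k) Wc :=
    CornerThetaFacts.continuousOn_V hx hs hΘ0 hΘs hT hZ hS hH hK hM hP (hVθ k)
      fun w hw => ⟨(hsg w hw).2.2.1.ne', (hsg w hw).2.2.2.1.ne'⟩
  exact hcont.comp ((continuous_const (y := w)).update _ continuous_id).continuousOn fun a ha => ha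

end Summit.KontsevichZagierPeriods.TerasomaMultiplication.MultiplicationAccessible

end
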